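import Mathlib
import Literature.MathematicalPhysics.QuantumFieldTheory.Balaban1983to89.B6Prop23CubeDepth

/-!
# `Balaban1983to89.B6CoverBox` — a COORDINATISED ONE-LEVEL MODEL of the cube cover 𝒟 ∕ partition of unity {h_□} of
(2.36) and of the enlarged cubes □̃ of p. 235: the cover, cube, collar, zone and lattice-sum binders of the
Proposition 2.3 certificate (`…B6Prop23CubeDepth.prop23_assembled_fine_twoLevel_cubes`) DISCHARGED on a box
(B6 = T. Bałaban, *Propagators and renormalization transformations for lattice gauge theories. II*, Commun. Math.
Phys. **96**, 223–250 (1984) [Balaban1984PropagatorsII]; the profile h is the one of [B5] = part I, Commun. Math.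
Phys. **95**, 17–40 (1984) [Balaban1984PropagatorsI], (1.118)).

CITATION HEADER (lean-in-tree rule 2026-08-18).  Cell `pub-balaban`, unit `b2b-balaban-b06-g17` (paper sub-cell B06,
gen 17 — the owner lineage of `…B6Prop23Assembled` ∕ `…B6Prop23DomainInput` ∕ `…B6Prop23TwoLevel` ∕
`…B6Prop23TwoLevelInputs` ∕ `…B6Prop23CubeDepth`, which this NEW LEAF imports (the last one; transitively the others and
`…B4Sect5Proof`, whose one-dimensional lattice sum `sum_exp_neg_abs_le` is reused BY NAME) and does not modify).
Sources: [B6] doi:10.1007/bf01240221, held `paper:balaban1984-cmp96-propagators-rt-ii`, journal page = PDF page + 222,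
quotations of pp. 229, 231, 235 read from the page renders `b2b-balaban-ref1/pages/1984-cmp96-propagators-rt-II/1984-
cmp96-propagators-rt-II-p007, p009, p013-x2.png` AS IMAGES this gen; [B5] doi:10.1007/bf01215753, journal page = PDF
page + 16, p. 36 read from `…/1984-cmp95-propagators-rt-I/1984-cmp95-propagators-rt-I-p020-x2.png` AS AN IMAGE this
gen.  Cell rows: GAPS C-b06g17-1 (this module), DIVERGENCE D-b06.37; census `HOME/b2b-balaban-b06-g15/CENSUS-B6-v1.md`
§6 hypothesis H-B6.5 (the cover binders), which this module addresses; journal claim COVER-BOX.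

THE PRINTED TEXT.  [B6] p. 229 [PDF 7]: *"Each set Λ_j is a sum of big blocks of the size ML^jη (Λ_j ⊂ T^{(j)}_{L^jη}),
or of the size M if Λ_j is scaled to unit lattice. We cover B^j(Λ_j) by a sum of cubes □ of the size 2ML^jη, each cube
being a sum of 2^d big blocks with a center y ∈ Λ_j (more exactly it belongs to the boundary of this set also). … We
construct also the corresponding family of functions h described in (1.118), and rescale them to proper scales. They
satisfy Σ_{□∈𝒟} h_□² = 1. (2.36)"*  [B5] p. 36 [PDF 20], before (1.118): *"cubes □_z of size 2M₀ and with a center at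
the point z ∈ T^{(k+m₀)}_{M₀}. These cubes cover the lattice T_η. We construct a partition of unity taking the functions
h_z(x) = Π_{μ=1}^d h((x_μ − z_μ)∕M₀), h ∈ C₀^∞(]−⅔, ⅔[), h(t) = 1 for t ∈ [−⅓, ⅓], h is chosen in such a way that
Σ_n h²(t − n) = 1, hence Σ_z h_z²(x) = 1. (1.118)"*  [B6] p. 235 [PDF 13]: *"If we have one scale, i.e. Λ_k = T_1^{(k)},
then the operator is a unit lattice operator. … We change this prescription a little bit; we take a second cube □̃
containing □ in the middle and of the size 4M and we take an inverse of the operator (Q′G′(□̃)²Q′*)↾□ instead of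
(Q′G′²Q′*)↾□."*  [B6] p. 231 [PDF 9], (2.46): *"d(y, y′) = inf_{Γ_{y,y′}} Σ_{j=0}^k (L^jη)^{−1}|Γ_{y,y′} ∩ B^j(Λ_j)|"* over
admissible contours whose part in B^j(Λ_j) *"consists of bonds of the lattice Λ_j"* — on ONE level and a box region this
is the number of unit-lattice bonds of a shortest staircase walk, i.e. the ℓ¹ lattice distance (dictionary D-pv08g2.1;
`…B6BoxCharts.zdGraph_dist_eq_latL1Dist`).

THE POINT.  In the tree's Proposition 2.3 certificate with cube data (gen 15, `prop23_assembled_fine_twoLevel_cubes`)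
the cover 𝒟, the partition {h_□} and the cubes □ ⊂ □̃ are ABSTRACT BINDERS over the abstract carrier `B6.Geometry`
(census H-B6.5): finite overlap `hover` (n₀), indicator values `hpf01`, □·h_□ = h_□ `hph`, (2.36) `h236`, the Lipschitz
bound `hLip` (s∕M), the support gap `hgap` (m_g M), supports `hpfsq`∕`hhsq`, the collar `hcollar` (M_c), the zone `hzone`
(w), the depth `hdepth` (κ), the non-empty zones `hN`, and on the metric side the pseudo-distance `hρ`, the level
separation `hsep`, (2.60) `h260`, the (2.61)-profile `hPr`∕`hK` and the generic-constant (2.61)∕(2.63) `h261σ`, `h261`,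
`h263`.  THIS MODULE builds the printed objects IN COORDINATES on one level ("Λ_j scaled to unit lattice", a box of
n^d big blocks of size M = m ∈ ℕ: sites {0, …, nm}^d, cube centres on the M-lattice {0, M, …, nM}^d including the
boundary, □_k = the 2M-cube {|x_μ − k_μM| ≤ M ∀μ}, □̃_k = the 4M-cube {|x_μ − k_μM| ≤ 2M ∀μ} "containing □ in the middle",
h_k(x) = Π_μ h((x_μ − k_μM)∕M) with an EXPLICIT profile h, the ℓ¹ metric d(x, y) = Σ_μ |x_μ − y_μ|, the zone N_k = the
closed w-neighbourhood of □̃_kᶜ) and PROVES every one of these binders there, with the constants n₀ = 2^d, s = 3π∕2,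
m_g = ⅓, M_c = M, κ = ½ (for 2w ≤ M), K(a) = (2(1 − e^{−a})^{−1})^d; the edge theorem `prop23_assembled_box` is the
certificate on this model with ONLY the analytic ∕ fine-lattice ∕ Q′-side binders and the size conditions left.

WHAT THIS MODULE PROVES (kernel-checked; no `sorry`, no axiom beyond Lean's three):
1. §1 the profile: `ramp`, `prof` (h(t) = cos((3π∕2)·max{0, min{|t| − ⅓, ⅓}})) with h = 1 on [−⅓, ⅓] (`prof_of_abs_le`),
   h = 0 off ]−⅔, ⅔[ (`prof_of_le_abs`), 0 ≤ h ≤ 1, |h(t) − h(t′)| ≤ (3π∕2)|t − t′| (`abs_prof_sub_le`), h(r)² + h(r − 1)² = 1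
   on [0, 1] (`prof_sq_add_prof_sq`: cos² + sin²) and the lattice identity Σ_{n=0}^{N} h(t − n)² = 1 for t ∈ [0, N]
   (`sum_prof_sq_eq_one`) — the printed *"Σ_n h²(t − n) = 1"* on a finite window.
2. §2 the box: coordinates `crd`, centres `ctr`, the ℓ¹ distance `bdist` (a pseudo-distance, `isPseudoDist_bdist`), the
   cubes `InCube` (□_k), `InBig` (□̃_k), the indicator `cubeInd` (= the multiplication operator □ of (2.70)∕(2.82)), the
   partition function `hprof` (h_□), the zone `zone`; and the binders: `cubeInd_zero_or_one` (hpf01), `cubeInd_mul_hprof`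
   (hph), `sum_hprof_sq` (h236: *"hence Σ_z h_z²(x) = 1"*, via `Finset.prod_univ_sum`), `card_filter_hprof_ne_zero_le`
   (hover, n₀ = 2^d: in each coordinate at most two centres kM lie within ⅔M of x_μ), `abs_hprof_sub_le` (hLip, s = 3π∕2,
   via |Πa − Πb| ≤ Σ|a_μ − b_μ| for factors in [0, 1], `abs_prod_sub_prod_le`), `gap_of_cubeInd_eq_zero` (hgap, m_g = ⅓:
   supp h_k ⊂ (4M∕3)-cube, □_kᶜ outside the 2M-cube), `inCube_of_hprof_ne_zero`∕`inCube_of_cubeInd_ne_zero` (hhsq∕hpfsq),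
   `collar` (hcollar with M_c = M: *"□̃ containing □ in the middle and of the size 4M"*), `mem_zone` (hzone by
   construction), `zone_nonempty` (hN, for d ≥ 1, M ≥ 1, n ≥ 5, w ≥ 0).
3. §3 the one-level geometry `boxGeo` (a `B6.Geometry` with this carrier and metric, constant scale j, M = m) and its
   metric binders: `boxGeo_levelSep` (hsep: one level, max{|j − j| − 1, 0} = 0), `boxGeo_ineq260` ((2.60) with right side
   e⁰), `boxGeo_profile` ((2.61)-profile with K(a) = (2(1 − e^{−a})^{−1})^d UNIFORMLY IN THE VOLUME n — the ℓ¹ sum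
   factorises over coordinates and each factor is `B4Sect5Proof.sum_exp_neg_abs_le`), `boxGeo_ineq261With`,
   `boxGeo_ineq263With` ((2.63) from (2.61) + (2.54) by `B6Lemma21Repaired.ineq263With_of_261With`).
4. §4 `prop23_assembled_box` — `B6Prop23CubeDepth.prop23_assembled_fine_twoLevel_cubes` ON `boxGeo` with □_i :=
   `cubeInd m i`, h_i := `hprof m i`, j_□ := j, n₀ := 2^d, s := 3π∕2, m_g := ⅓, N_i := `zone m w i`, □ ∕ □̃ := `InCube` ∕
   `InBig`, M_c := M, κ := ½, K := `Kbox d`, c_σ := K(σ(δ − α′δ₀)∕3), c := K(δ₁∕2), and the binders hρ, hsep, hM, h260, hK,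
   hPr, h261σ, h261, h263, hc, hs, hmg, hover, hpf01, hph, h236, hLip, hcube, hgap, hN, hκ, hpfsq, hhsq, hcollar, hzone,
   hdepth ALL DISCHARGED (26 binders); kept verbatim: L, η, R and their sizes (hL, hη, hRM, hsize, hthr), the rates
   (hα′, hκδ, hsplit, with 0 < δ₁ and 0 < σ(δ − α′δ₀)∕3 for the two (2.61) constants), the kernels X, X̃_i, C_i and (2.81),
   (2.70), the fine-lattice data blk ∕ χ_i ∕ D_i ∕ G′ ∕ G′(□̃_i) with their majorants, the Q′-data, the dictionary, the zone
   width 0 ≤ w ≤ M∕2, and the threshold «M large» `hKM`; conclusion verbatim (two-sided inverse of Q′G′²Q′* in the pairing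
   (2.69), the glued form (2.86), uniqueness, (2.87)).
5. §5 `coverBox_nonvacuous`: the model hypotheses d ≥ 1, M ≥ 1, n ≥ 5, 0 ≤ w, 2w ≤ M hold together (d = 1, M = 2, n = 5,
   w = 1), and on that instance every cube index has a non-empty zone and Σ_k h_k² = 1 holds at every site.

TYPING ∕ DIVERGENCE (cell DIVERGENCE.md D-b06.37).  (a) ONE LEVEL: the carrier is a single Λ_j scaled to the unit
lattice (p. 235 *"If we have one scale … the operator is a unit lattice operator"*); the two-level case of p. 235 (*"or
it intersects B^{j+1}(Λ_{j+1}) also"*) stays with the abstract binders of `prop23_assembled_fine_twoLevel_cubes` (κ ≍ 1∕(2L)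
there, `B6Prop23CubeDepth.depth_interface`).  (b) BOX, NOT TORUS: the region is the box {0, …, nM}^d with cube centres
on its boundary included (p. 229 *"more exactly it belongs to the boundary of this set also"*); cubes are clipped by the
region; no periodic identification.  (c) THE METRIC is posited as the ℓ¹ lattice distance in L^jη-units, which is (2.46)
on a one-level box region by the staircase-walk dictionary D-pv08g2.1 (`…B6BoxCharts`); the formal identification with
the realised metric of `…B6Geometry` is NOT made here.  (d) THE PROFILE h is an explicit LIPSCHITZ function (cos of a
piecewise-linear ramp), not C₀^∞ as printed: the typed Proposition 2.3 chain consumes only the Lipschitz bound `hLip`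
(constant s∕M, here s = 3π∕2) and never a derivative of h; supp h = [−⅔, ⅔] is the closure of the printed open interval
(immaterial on the lattice).  (e) CUBE SIZE M₀ = M: [B5] writes M₀ for the cube lattice, [B6] p. 229 takes the cubes of
size 2M on the M-lattice of big blocks; the model takes M₀ = M ∈ ℕ, M ≥ 1.  (f) The zone N_k is the closed
w-neighbourhood of □̃_kᶜ in the d-metric (it contains □̃_kᶜ, where the cut-off χ_□̃ vanishes, and the shell of width w
inside □̃_k carrying the commutator of χ_□̃ with a range-w operator); that the fine-lattice commutator majorants
`hKGw`∕`hKG` live on it is the located input it was upstream.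

HONEST SCOPE ∕ NOT CLAIMED.  Bookkeeping: the module shows that the 26 cover∕metric binders of the located Proposition 2.3
certificate are SATISFIABLE BY THE PRINTED CONSTRUCTION (in coordinates, one level), with volume-independent constants;
it does not touch any analytic input of Sect. B ((2.67)–(2.68), (2.76)–(2.81), the change-of-domain estimate, the
Q′-bounds — all carried verbatim), does not construct the fine-lattice cut-offs χ_□̃ or G′(□̃), does not treat two levels
or the torus, and says nothing about d = 4, the continuum, or the summit `YangMillsMassGap`.  VALUE = kernel bookkeeping
of ONE technical paper at fixed lattice spacing; NOT summit progress.
-/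

namespace Literature.MathematicalPhysics.QuantumFieldTheory.Balaban1983to89.B6CoverBox

open Finset Real
open B4Sect5Torus (IsPseudoDist)
open B6DomainChange (Profile)
open B6RandomWalk (HasMajorant Ineq260 Triangle254)
open B6RandomWalkHom (HasMajorantHom)
open B6DomainMajorant (Ctot)
open B6Expansion282 (kerOp locOp Cglued R282)
open B6Prop23Chain (mat)
open B6Lemma21Repaired (Ineq261With Ineq263With)
open B6Ineq268 (LevelSep mx)
open B6Prop23TwoLevel (K285TL)
open B6Prop23CubeDepth (prop23_assembled_fine_twoLevel_cubes depth_half)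

/-! ## §1  The one-dimensional profile h of [B5] (1.118) — an explicit Lipschitz choice -/

section OneDim

/-- The ramp r(t) = max{0, min{|t| − ⅓, ⅓}} ∈ [0, ⅓]: r = 0 on [−⅓, ⅓], r = ⅓ outside ]−⅔, ⅔[, linear in between.
[folklore] -/
noncomputable def ramp (t : ℝ) : ℝ := max 0 (min (|t| - 1 / 3) (1 / 3))

/-- The profile h(t) = cos((3π∕2)·r(t)) — an explicit LIPSCHITZ instance of the printed h of [B5] (1.118), p. 36:
*"h ∈ C₀^∞(]−⅔, ⅔[), h(t) = 1 for t ∈ [−⅓, ⅓], h is chosen in such a way that Σ_n h²(t − n) = 1"* — h = 1 on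
[−⅓, ⅓], h = 0 outside ]−⅔, ⅔[, 0 ≤ h ≤ 1, Σ_n h(t − n)² = 1 (`sum_prof_sq_eq_one`); smoothness is NOT modelled (only the
Lipschitz bound is consumed downstream, as `hLip`). [cite: Balaban1984PropagatorsI, (1.118) p.36] -/
noncomputable def prof (t : ℝ) : ℝ := Real.cos (3 * π / 2 * ramp t)

/-- 0 ≤ r ≤ ⅓. [folklore] -/
theorem ramp_bounds (t : ℝ) : 0 ≤ ramp t ∧ ramp t ≤ 1 / 3 :=
  ⟨le_max_left _ _, max_le (by norm_num) (min_le_right _ _)⟩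

/-- r = 0 on [−⅓, ⅓]. [folklore] -/
theorem ramp_of_abs_le {t : ℝ} (h : |t| ≤ 1 / 3) : ramp t = 0 :=
  max_eq_left ((min_le_left _ _).trans (by linarith))

/-- r = ⅓ outside ]−⅔, ⅔[. [folklore] -/
theorem ramp_of_le_abs {t : ℝ} (h : 2 / 3 ≤ |t|) : ramp t = 1 / 3 := by
  unfold ramp
  rw [min_eq_right (by linarith), max_eq_right (by norm_num)]

/-- The complementary ramps on [0, 1]: r(t) + r(t − 1) = ⅓. [folklore] -/
theorem ramp_add_ramp_sub_one {r : ℝ} (h0 : 0 ≤ r) (h1 : r ≤ 1) : ramp r + ramp (r - 1) = 1 / 3 := by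
  have ha : |r| = r := abs_of_nonneg h0
  have hb : |r - 1| = 1 - r := by
    rw [abs_sub_comm]
    exact abs_of_nonneg (by linarith)
  simp only [ramp, ha, hb, max_def, min_def]
  split_ifs <;> linarith

/-- h = 1 on [−⅓, ⅓] (printed: *"h(t) = 1 for t ∈ [−⅓, ⅓]"*). [cite: Balaban1984PropagatorsI, (1.118) p.36] -/
theorem prof_of_abs_le {t : ℝ} (h : |t| ≤ 1 / 3) : prof t = 1 := by
  rw [prof, ramp_of_abs_le h, mul_zero, Real.cos_zero]

/-- h = 0 outside ]−⅔, ⅔[ (printed: *"h ∈ C₀^∞(]−⅔, ⅔[)"*). [cite: Balaban1984PropagatorsI, (1.118) p.36] -/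
theorem prof_of_le_abs {t : ℝ} (h : 2 / 3 ≤ |t|) : prof t = 0 := by
  rw [prof, ramp_of_le_abs h, show 3 * π / 2 * (1 / 3) = π / 2 by ring, Real.cos_pi_div_two]

/-- h ≥ 0. [folklore] -/
theorem prof_nonneg (t : ℝ) : 0 ≤ prof t := by
  unfold prof
  obtain ⟨h0, h1⟩ := ramp_bounds t
  have hπ := Real.pi_pos
  apply Real.cos_nonneg_of_neg_pi_div_two_le_of_le
  · nlinarith
  · nlinarith

/-- h ≤ 1. [folklore] -/
theorem prof_le_one (t : ℝ) : prof t ≤ 1 := Real.cos_le_one _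

/-- supp h ⊂ [−⅔, ⅔]: h(t) ≠ 0 ⟹ |t| < ⅔. [cite: Balaban1984PropagatorsI, (1.118) p.36] -/
theorem abs_lt_of_prof_ne_zero {t : ℝ} (h : prof t ≠ 0) : |t| < 2 / 3 := by
  by_contra hc
  exact h (prof_of_le_abs (not_lt.mp hc))

/-- h is (3π∕2)-Lipschitz (the ramp r is 1-Lipschitz and cos is 1-Lipschitz). [folklore] -/
theorem abs_prof_sub_le (t t' : ℝ) : |prof t - prof t'| ≤ 3 * π / 2 * |t - t'| := by
  have hramp : |ramp t - ramp t'| ≤ |t - t'| := by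
    unfold ramp
    have h1 := abs_max_sub_max_le_max (0 : ℝ) (min (|t| - 1 / 3) (1 / 3)) 0 (min (|t'| - 1 / 3) (1 / 3))
    have h2 := abs_min_sub_min_le_max (|t| - 1 / 3) (1 / 3 : ℝ) (|t'| - 1 / 3) (1 / 3)
    have h3 := abs_abs_sub_abs_le_abs_sub t t'
    have h4 : |(|t| - 1 / 3) - (|t'| - 1 / 3)| = |(|t| - |t'|)| := by rw [sub_sub_sub_cancel_right]
    rw [sub_self, abs_zero] at h1 h2
    rw [h4] at h2
    have h5 : max |(|t| - |t'|)| 0 ≤ |t - t'| := max_le h3 (abs_nonneg _)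
    have h6 : max 0 |min (|t| - 1 / 3) (1 / 3) - min (|t'| - 1 / 3) (1 / 3)| ≤ |t - t'| :=
      max_le (abs_nonneg _) (h2.trans h5)
    exact h1.trans h6
  unfold prof
  have hπ : (0 : ℝ) < 3 * π / 2 := by positivity
  calc |Real.cos (3 * π / 2 * ramp t) - Real.cos (3 * π / 2 * ramp t')|
      ≤ |3 * π / 2 * ramp t - 3 * π / 2 * ramp t'| := Real.abs_cos_sub_cos_le _ _
    _ = 3 * π / 2 * |ramp t - ramp t'| := by rw [← mul_sub, abs_mul, abs_of_pos hπ]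
    _ ≤ 3 * π / 2 * |t - t'| := mul_le_mul_of_nonneg_left hramp hπ.le

/-- The two overlapping profiles on [0, 1] square-sum to one: h(r)² + h(r − 1)² = cos² + sin² = 1. [folklore] -/
theorem prof_sq_add_prof_sq {r : ℝ} (h0 : 0 ≤ r) (h1 : r ≤ 1) : prof r ^ 2 + prof (r - 1) ^ 2 = 1 := by
  have h : ramp (r - 1) = 1 / 3 - ramp r := by linarith [ramp_add_ramp_sub_one h0 h1]
  unfold prof
  rw [h, show 3 * π / 2 * (1 / 3 - ramp r) = π / 2 - 3 * π / 2 * ramp r by ring, Real.cos_pi_div_two_sub,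
    Real.cos_sq_add_sin_sq]

/-- **The printed partition identity on a finite window**: Σ_{n=0}^{N} h(t − n)² = 1 for 0 ≤ t ≤ N (printed: *"h is
chosen in such a way that Σ_n h²(t − n) = 1"*; outside the window every further term vanishes).
[cite: Balaban1984PropagatorsI, (1.118) p.36] -/
theorem sum_prof_sq_eq_one (N : ℕ) :
    ∀ t : ℝ, 0 ≤ t → t ≤ N → ∑ k ∈ Finset.range (N + 1), prof (t - k) ^ 2 = 1 := by
  induction N with
  | zero =>
      intro t h0 h1
      have ht : t = 0 := le_antisymm (by simpa using h1) h0
      subst ht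
      rw [Finset.sum_range_one, Nat.cast_zero, sub_zero, prof_of_abs_le (by norm_num), one_pow]
  | succ n ih =>
      intro t h0 h1
      push_cast at h1
      by_cases ht : 1 ≤ t
      · rw [Finset.sum_range_succ']
        have hz : prof (t - ((0 : ℕ) : ℝ)) ^ 2 = 0 := by
          rw [Nat.cast_zero, sub_zero, prof_of_le_abs (by rw [abs_of_nonneg h0]; linarith),
            zero_pow two_ne_zero]
        rw [hz, add_zero, ← ih (t - 1) (by linarith) (by linarith)]
        refine Finset.sum_congr rfl fun k _ => ?_
        rw [show t - ((k + 1 : ℕ) : ℝ) = t - 1 - k by push_cast; ring]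
      · rw [not_le] at ht
        rw [Finset.sum_range_succ', Finset.sum_range_succ']
        have hz : ∀ k ∈ Finset.range n, prof (t - ((k + 1 + 1 : ℕ) : ℝ)) ^ 2 = 0 := by
          intro k _
          have hk : (0 : ℝ) ≤ k := Nat.cast_nonneg k
          have hneg : t - ((k + 1 + 1 : ℕ) : ℝ) ≤ 0 := by push_cast; linarith
          have habs : 2 / 3 ≤ |t - ((k + 1 + 1 : ℕ) : ℝ)| := by
            rw [abs_of_nonpos hneg]
            push_cast
            linarith
          rw [prof_of_le_abs habs, zero_pow two_ne_zero]
        have hkey := prof_sq_add_prof_sq h0 ht.le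
        rw [Finset.sum_eq_zero hz, zero_add]
        simp only [Nat.cast_zero, Nat.cast_succ, zero_add, sub_zero]
        linarith

end OneDim

/-! ## §2  The box model: sites {0,…,nM}^d, centres on the M-lattice, the cubes □ ⊂ □̃, h_□, the zone -/

section Box

variable {d S C : ℕ}

/-- The real coordinate x_μ of a box site (unit lattice, *"Λ_j scaled to unit lattice"* p. 229). [folklore] -/
noncomputable def crd (x : Fin d → Fin S) (μ : Fin d) : ℝ := ((x μ : ℕ) : ℝ)

/-- The coordinate k_μ·M of the centre of the cube with index k (centres on the M-lattice of big blocks, p. 229 *"with a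
center y ∈ Λ_j (more exactly it belongs to the boundary of this set also)"*). [cite: Balaban1984PropagatorsII, p.229 before (2.36)] -/
noncomputable def ctr (m : ℕ) (k : Fin d → Fin C) (μ : Fin d) : ℝ := ((k μ : ℕ) : ℝ) * m

/-- The ℓ¹ lattice distance Σ_μ |x_μ − y_μ| in L^jη-units — (2.46) on a one-level box region (dictionary D-pv08g2.1).
[cite: Balaban1984PropagatorsII, (2.46) p.231] -/
noncomputable def bdist (x y : Fin d → Fin S) : ℝ := ∑ μ, |crd x μ - crd y μ|

/-- d(x, x) = 0. [folklore] -/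
theorem bdist_self (x : Fin d → Fin S) : bdist x x = 0 := by
  simp [bdist]

/-- d(x, y) = d(y, x). [folklore] -/
theorem bdist_comm (x y : Fin d → Fin S) : bdist x y = bdist y x :=
  Finset.sum_congr rfl fun _ _ => abs_sub_comm _ _

/-- (2.54) for the ℓ¹ distance: d(x, z) ≤ d(x, y) + d(y, z). [cite: Balaban1984PropagatorsII, (2.54) p.233] -/
theorem bdist_triangle (x y z : Fin d → Fin S) : bdist x z ≤ bdist x y + bdist y z := by
  unfold bdist
  rw [← Finset.sum_add_distrib]
  exact Finset.sum_le_sum fun μ _ => abs_sub_le _ _ _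

/-- d ≥ 0. [folklore] -/
theorem bdist_nonneg (x y : Fin d → Fin S) : 0 ≤ bdist x y :=
  Finset.sum_nonneg fun _ _ => abs_nonneg _

/-- One coordinate difference is at most the ℓ¹ distance. [folklore] -/
theorem abs_crd_sub_le_bdist (x y : Fin d → Fin S) (μ : Fin d) : |crd x μ - crd y μ| ≤ bdist x y :=
  Finset.single_le_sum (f := fun ν => |crd x ν - crd y ν|) (fun _ _ => abs_nonneg _) (Finset.mem_univ μ)

/-- The ℓ¹ lattice distance is a pseudo-distance (the binder `hρ`). [folklore] -/
theorem isPseudoDist_bdist : IsPseudoDist (bdist : (Fin d → Fin S) → (Fin d → Fin S) → ℝ) :=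
  ⟨bdist_comm, bdist_self, bdist_triangle⟩

/-- x ∈ □_k, the cube *"of the size 2M"* with centre kM: |x_μ − k_μM| ≤ M for every μ.
[cite: Balaban1984PropagatorsII, p.229 before (2.36)] -/
def InCube (m : ℕ) (k : Fin d → Fin C) (x : Fin d → Fin S) : Prop := ∀ μ, |crd x μ - ctr m k μ| ≤ m

/-- x ∈ □̃_k, the *"second cube □̃ containing □ in the middle and of the size 4M"*: |x_μ − k_μM| ≤ 2M for every μ.
[cite: Balaban1984PropagatorsII, p.235 before (2.70)] -/
def InBig (m : ℕ) (k : Fin d → Fin C) (x : Fin d → Fin S) : Prop := ∀ μ, |crd x μ - ctr m k μ| ≤ 2 * m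

open Classical in
/-- The indicator of □_k (the multiplication operator □ of (2.82)). [cite: Balaban1984PropagatorsII, p.237 (2.82)] -/
noncomputable def cubeInd (m : ℕ) (k : Fin d → Fin C) (x : Fin d → Fin S) : ℝ := if InCube m k x then 1 else 0

/-- h_□ for □ = □_k: h_k(x) = Π_μ h((x_μ − k_μM)∕M) (printed [B5] (1.118) *"h_z(x) = Π_{μ=1}^d h((x_μ − z_μ)∕M₀)"*, with
M₀ = M as on [B6] p. 229). [cite: Balaban1984PropagatorsI, (1.118) p.36] -/
noncomputable def hprof (m : ℕ) (k : Fin d → Fin C) (x : Fin d → Fin S) : ℝ :=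
  ∏ μ, prof ((crd x μ - ctr m k μ) / m)

open Classical in
/-- The zone N_k: the sites within d-distance w of the outside of □̃_k (it contains □̃_kᶜ). [folklore] -/
noncomputable def zone (m : ℕ) (w : ℝ) (k : Fin d → Fin C) : Finset (Fin d → Fin S) :=
  Finset.univ.filter fun x => ∃ z : Fin d → Fin S, ¬ InBig m k z ∧ bdist x z ≤ w

/-- □ takes the values 0, 1 (the binder `hpf01`). [folklore] -/
theorem cubeInd_zero_or_one (m : ℕ) (k : Fin d → Fin C) (x : Fin d → Fin S) :
    cubeInd m k x = 0 ∨ cubeInd m k x = 1 := by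
  unfold cubeInd
  split_ifs <;> simp

/-- □ = 1 on □. [folklore] -/
theorem cubeInd_eq_one {m : ℕ} {k : Fin d → Fin C} {x : Fin d → Fin S} (h : InCube m k x) : cubeInd m k x = 1 := by
  unfold cubeInd
  rw [if_pos h]

/-- □ = 0 off □. [folklore] -/
theorem cubeInd_eq_zero {m : ℕ} {k : Fin d → Fin C} {x : Fin d → Fin S} (h : ¬ InCube m k x) :
    cubeInd m k x = 0 := by
  unfold cubeInd
  rw [if_neg h]

/-- supp □ ⊂ □ (the binder `hpfsq`). [folklore] -/
theorem inCube_of_cubeInd_ne_zero {m : ℕ} {k : Fin d → Fin C} {x : Fin d → Fin S} (h : cubeInd m k x ≠ 0) :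
    InCube m k x := by
  by_contra hc
  exact h (cubeInd_eq_zero hc)

/-- h_□ ≥ 0. [folklore] -/
theorem hprof_nonneg (m : ℕ) (k : Fin d → Fin C) (x : Fin d → Fin S) : 0 ≤ hprof m k x :=
  Finset.prod_nonneg fun _ _ => prof_nonneg _

/-- h_□ ≤ 1. [folklore] -/
theorem hprof_le_one (m : ℕ) (k : Fin d → Fin C) (x : Fin d → Fin S) : hprof m k x ≤ 1 :=
  Finset.prod_le_one (fun _ _ => prof_nonneg _) fun _ _ => prof_le_one _

/-- supp h_□ lies in the (4M∕3)-cube: h_k(x) ≠ 0 ⟹ |x_μ − k_μM| < ⅔M for every μ ([B5] (1.118): supp h ⊂ ]−⅔, ⅔[).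
[cite: Balaban1984PropagatorsI, (1.118) p.36] -/
theorem abs_sub_ctr_lt_of_hprof_ne_zero {m : ℕ} (hm : 0 < m) {k : Fin d → Fin C} {x : Fin d → Fin S}
    (h : hprof m k x ≠ 0) (μ : Fin d) : |crd x μ - ctr m k μ| < 2 / 3 * m := by
  have hm' : (0 : ℝ) < m := by exact_mod_cast hm
  have hfac : prof ((crd x μ - ctr m k μ) / m) ≠ 0 :=
    fun h0 => h (Finset.prod_eq_zero (Finset.mem_univ μ) h0)
  have := abs_lt_of_prof_ne_zero hfac
  rw [abs_div, abs_of_pos hm', div_lt_iff₀ hm'] at this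
  linarith

/-- supp h_□ ⊂ □ (the binder `hhsq`): ⅔M ≤ M. [cite: Balaban1984PropagatorsII, p.229 (2.36)] -/
theorem inCube_of_hprof_ne_zero {m : ℕ} (hm : 0 < m) {k : Fin d → Fin C} {x : Fin d → Fin S}
    (h : hprof m k x ≠ 0) : InCube m k x := by
  intro μ
  have := abs_sub_ctr_lt_of_hprof_ne_zero hm h μ
  have hm' : (0 : ℝ) ≤ m := Nat.cast_nonneg m
  linarith

/-- □·h_□ = h_□ (the binder `hph`: h_□ is carried by its cube). [cite: Balaban1984PropagatorsII, p.229 (2.36)] -/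
theorem cubeInd_mul_hprof {m : ℕ} (hm : 0 < m) (k : Fin d → Fin C) (x : Fin d → Fin S) :
    cubeInd m k x * hprof m k x = hprof m k x := by
  by_cases h : hprof m k x = 0
  · rw [h, mul_zero]
  · rw [cubeInd_eq_one (inCube_of_hprof_ne_zero hm h), one_mul]

/-- **(2.36) in the model** (the binder `h236`): Σ_k h_k(x)² = 1 at every site of the box — the product structure
h_k(x)² = Π_μ h((x_μ − k_μM)∕M)² turns the sum over the centres k ∈ {0, …, n}^d into the product over μ of the
one-dimensional window sums Σ_{j=0}^{n} h(x_μ∕M − j)² = 1 (`sum_prof_sq_eq_one`, 0 ≤ x_μ∕M ≤ n) — printed *"hence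
Σ_z h_z²(x) = 1"*. [cite: Balaban1984PropagatorsII, (2.36) p.229] -/
theorem sum_hprof_sq {n m : ℕ} (hm : 0 < m) (x : Fin d → Fin (n * m + 1)) :
    ∑ k : Fin d → Fin (n + 1), hprof m k x ^ 2 = 1 := by
  classical
  have hm' : (0 : ℝ) < m := by exact_mod_cast hm
  have hcoord : ∀ μ : Fin d, ∑ j : Fin (n + 1), prof ((crd x μ - ((j : ℕ) : ℝ) * m) / m) ^ 2 = 1 := by
    intro μ
    have hx0 : 0 ≤ crd x μ / m := div_nonneg (Nat.cast_nonneg _) hm'.le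
    have hx1 : crd x μ / m ≤ n := by
      rw [div_le_iff₀ hm']
      have : (x μ : ℕ) ≤ n * m := Nat.lt_succ_iff.mp (x μ).isLt
      unfold crd
      exact_mod_cast this
    calc ∑ j : Fin (n + 1), prof ((crd x μ - ((j : ℕ) : ℝ) * m) / m) ^ 2
        = ∑ j ∈ Finset.range (n + 1), prof ((crd x μ - (j : ℝ) * m) / m) ^ 2 :=
          Fin.sum_univ_eq_sum_range (fun j : ℕ => prof ((crd x μ - (j : ℝ) * m) / m) ^ 2) (n + 1)
      _ = ∑ j ∈ Finset.range (n + 1), prof (crd x μ / m - j) ^ 2 := by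
          refine Finset.sum_congr rfl fun j _ => ?_
          rw [sub_div, mul_div_cancel_right₀ _ hm'.ne']
      _ = 1 := sum_prof_sq_eq_one n (crd x μ / m) hx0 hx1
  calc ∑ k : Fin d → Fin (n + 1), hprof m k x ^ 2
      = ∑ k ∈ Fintype.piFinset (fun _ : Fin d => (Finset.univ : Finset (Fin (n + 1)))),
          ∏ μ, prof ((crd x μ - ((k μ : ℕ) : ℝ) * m) / m) ^ 2 := by
        rw [Fintype.piFinset_univ]
        refine Finset.sum_congr rfl fun k _ => ?_
        simp only [hprof, ctr, ← Finset.prod_pow]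
    _ = ∏ μ : Fin d, ∑ j : Fin (n + 1), prof ((crd x μ - ((j : ℕ) : ℝ) * m) / m) ^ 2 :=
        (Finset.prod_univ_sum (fun _ : Fin d => (Finset.univ : Finset (Fin (n + 1))))
          (fun μ (j : Fin (n + 1)) => prof ((crd x μ - ((j : ℕ) : ℝ) * m) / m) ^ 2)).symm
    _ = 1 := Finset.prod_eq_one fun μ _ => hcoord μ

/-- **Finite overlap** (the binder `hover`, n₀ = 2^d): at every site at most 2^d of the functions h_k are non-zero —
h_k(x) ≠ 0 forces |x_μ − k_μM| < ⅔M in each coordinate, two such centres k_μ, k_μ′ satisfy |k_μ − k_μ′| < 4∕3, so they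
are consecutive integers: each coordinate admits at most two, and the indices lie in a product of sets of size ≤ 2
(p. 229: *"each cube being a sum of 2^d big blocks"* — the 2M-cubes on the M-lattice overlap 2^d-fold).
[cite: Balaban1984PropagatorsII, p.229 before (2.36)] -/
theorem card_filter_hprof_ne_zero_le {n m : ℕ} (hm : 0 < m) (x : Fin d → Fin S) :
    (Finset.univ.filter fun k : Fin d → Fin (n + 1) => hprof m k x ≠ 0).card ≤ 2 ^ d := by
  classical
  have hm' : (0 : ℝ) < m := by exact_mod_cast hm
  set T : Fin d → Finset (Fin (n + 1)) := fun μ =>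
    Finset.univ.filter fun j : Fin (n + 1) => |crd x μ - ((j : ℕ) : ℝ) * m| < 2 / 3 * m with hT
  have hsub : (Finset.univ.filter fun k : Fin d → Fin (n + 1) => hprof m k x ≠ 0) ⊆ Fintype.piFinset T := by
    intro k hk
    rw [Finset.mem_filter] at hk
    rw [Fintype.mem_piFinset]
    intro μ
    simp only [hT, Finset.mem_filter, Finset.mem_univ, true_and]
    exact abs_sub_ctr_lt_of_hprof_ne_zero hm hk.2 μ
  have hTcard : ∀ μ, (T μ).card ≤ 2 := by
    intro μ
    rcases (T μ).eq_empty_or_nonempty with h0 | hne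
    · rw [h0, Finset.card_empty]
      exact Nat.zero_le _
    · have haT : (T μ).min' hne ∈ T μ := Finset.min'_mem _ _
      have ha' := (Finset.mem_filter.mp haT).2
      have hbound : ∀ j ∈ T μ, (j : ℕ) = ((T μ).min' hne : ℕ) ∨ (j : ℕ) = ((T μ).min' hne : ℕ) + 1 := by
        intro j hj
        have h1 : (((T μ).min' hne : ℕ)) ≤ (j : ℕ) := Finset.min'_le _ _ hj
        have hj' := (Finset.mem_filter.mp hj).2
        have e1 := abs_sub_lt_iff.mp hj'
        have e2 := abs_sub_lt_iff.mp ha'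
        have h2 : (((j : ℕ) : ℝ) - (((T μ).min' hne : ℕ) : ℝ)) * m < 4 / 3 * m := by
          linarith [e1.1, e1.2, e2.1, e2.2]
        have h3 : ((j : ℕ) : ℝ) - (((T μ).min' hne : ℕ) : ℝ) < 4 / 3 := lt_of_mul_lt_mul_right h2 hm'.le
        have h4 : (j : ℕ) < ((T μ).min' hne : ℕ) + 2 := by
          have : ((j : ℕ) : ℝ) < (((T μ).min' hne : ℕ) : ℝ) + 2 := by linarith
          exact_mod_cast this
        omega
      calc (T μ).card ≤ ({((T μ).min' hne : ℕ), ((T μ).min' hne : ℕ) + 1} : Finset ℕ).card :=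
          Finset.card_le_card_of_injOn (fun j : Fin (n + 1) => (j : ℕ))
            (fun j hj => by
              rcases hbound j (Finset.mem_coe.mp hj) with h | h
              · simp [h]
              · simp [h])
            (fun j _ j' _ h => Fin.ext h)
        _ ≤ 2 := Finset.card_le_two
  calc (Finset.univ.filter fun k : Fin d → Fin (n + 1) => hprof m k x ≠ 0).card
      ≤ (Fintype.piFinset T).card := Finset.card_le_card hsub
    _ = ∏ μ, (T μ).card := Fintype.card_piFinset T
    _ ≤ 2 ^ (Finset.univ : Finset (Fin d)).card := Finset.prod_le_pow_card _ _ _ fun μ _ => hTcard μ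
    _ = 2 ^ d := by rw [Finset.card_univ, Fintype.card_fin]

/-- |Π_i a_i − Π_i b_i| ≤ Σ_i |a_i − b_i| for factors in [0, 1]. [folklore] -/
theorem abs_prod_sub_prod_le {ι : Type*} (s : Finset ι) {f g : ι → ℝ} (hf : ∀ i, 0 ≤ f i ∧ f i ≤ 1)
    (hg : ∀ i, 0 ≤ g i ∧ g i ≤ 1) : |∏ i ∈ s, f i - ∏ i ∈ s, g i| ≤ ∑ i ∈ s, |f i - g i| := by
  classical
  refine Finset.induction_on s ?_ ?_
  · simp
  · intro a s has ih
    rw [Finset.prod_insert has, Finset.prod_insert has, Finset.sum_insert has]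
    have hQ0 : 0 ≤ ∏ i ∈ s, g i := Finset.prod_nonneg fun i _ => (hg i).1
    have hQ1 : ∏ i ∈ s, g i ≤ 1 := Finset.prod_le_one (fun i _ => (hg i).1) fun i _ => (hg i).2
    have hfa := hf a
    calc |f a * ∏ i ∈ s, f i - g a * ∏ i ∈ s, g i|
        = |f a * (∏ i ∈ s, f i - ∏ i ∈ s, g i) + (f a - g a) * ∏ i ∈ s, g i| := by
          congr 1
          ring
      _ ≤ |f a * (∏ i ∈ s, f i - ∏ i ∈ s, g i)| + |(f a - g a) * ∏ i ∈ s, g i| := abs_add_le _ _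
      _ = f a * |∏ i ∈ s, f i - ∏ i ∈ s, g i| + |f a - g a| * ∏ i ∈ s, g i := by
          rw [abs_mul, abs_mul, abs_of_nonneg hfa.1, abs_of_nonneg hQ0]
      _ ≤ 1 * (∑ i ∈ s, |f i - g i|) + |f a - g a| * 1 :=
          add_le_add (mul_le_mul hfa.2 ih (abs_nonneg _) zero_le_one)
            (mul_le_mul_of_nonneg_left hQ1 (abs_nonneg _))
      _ = |f a - g a| + ∑ i ∈ s, |f i - g i| := by ring

/-- **The Lipschitz bound** (the binder `hLip`, s = 3π∕2): |h_k(x) − h_k(y)| ≤ (3π∕2)∕M · d(x, y) — h is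
(3π∕2)-Lipschitz in each rescaled coordinate (x_μ − k_μM)∕M and |Πa − Πb| ≤ Σ|a_μ − b_μ|.
[cite: Balaban1984PropagatorsII, (2.83) p.237 «O(M⁻¹)»] -/
theorem abs_hprof_sub_le {m : ℕ} (hm : 0 < m) (k : Fin d → Fin C) (x y : Fin d → Fin S) :
    |hprof m k x - hprof m k y| ≤ 3 * π / 2 / m * bdist x y := by
  have hm' : (0 : ℝ) < m := by exact_mod_cast hm
  unfold hprof bdist
  calc |∏ μ, prof ((crd x μ - ctr m k μ) / m) - ∏ μ, prof ((crd y μ - ctr m k μ) / m)|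
      ≤ ∑ μ, |prof ((crd x μ - ctr m k μ) / m) - prof ((crd y μ - ctr m k μ) / m)| :=
        abs_prod_sub_prod_le _ (fun μ => ⟨prof_nonneg _, prof_le_one _⟩)
          (fun μ => ⟨prof_nonneg _, prof_le_one _⟩)
    _ ≤ ∑ μ, 3 * π / 2 / m * |crd x μ - crd y μ| := by
        refine Finset.sum_le_sum fun μ _ => ?_
        calc |prof ((crd x μ - ctr m k μ) / m) - prof ((crd y μ - ctr m k μ) / m)|
            ≤ 3 * π / 2 * |(crd x μ - ctr m k μ) / m - (crd y μ - ctr m k μ) / m| := abs_prof_sub_le _ _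
          _ = 3 * π / 2 / m * |crd x μ - crd y μ| := by
              rw [← sub_div, abs_div, abs_of_pos hm', sub_sub_sub_cancel_right]
              ring
    _ = 3 * π / 2 / m * ∑ μ, |crd x μ - crd y μ| := by rw [Finset.mul_sum]

/-- **The support gap** (the binder `hgap`, m_g = ⅓): □_k(y) = 0 and h_k(y″) ≠ 0 ⟹ d(y, y″) ≥ M∕3 — in some
coordinate |y_μ − k_μM| > M while |y″_μ − k_μM| < ⅔M. [cite: Balaban1984PropagatorsII, p.229 (2.36); p.237 (2.83)] -/
theorem gap_of_cubeInd_eq_zero {m : ℕ} (hm : 0 < m) {k : Fin d → Fin C} {y y'' : Fin d → Fin S}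
    (hy : cubeInd m k y = 0) (hy'' : hprof m k y'' ≠ 0) : 1 / 3 * (m : ℝ) ≤ bdist y y'' := by
  have hnc : ¬ InCube m k y := by
    intro h
    rw [cubeInd_eq_one h] at hy
    exact one_ne_zero hy
  obtain ⟨μ, hμ⟩ := not_forall.mp hnc
  have h1 : (m : ℝ) < |crd y μ - ctr m k μ| := not_le.mp hμ
  have h2 := abs_sub_ctr_lt_of_hprof_ne_zero hm hy'' μ
  have h3 : |crd y μ - ctr m k μ| - |crd y'' μ - ctr m k μ| ≤ |crd y μ - crd y'' μ| := by
    have := abs_sub_abs_le_abs_sub (crd y μ - ctr m k μ) (crd y'' μ - ctr m k μ)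
    rwa [sub_sub_sub_cancel_right] at this
  linarith [abs_crd_sub_le_bdist y y'' μ]

/-- **The collar** (the binder `hcollar`, M_c = M): a site of □_k and a site outside □̃_k are at d-distance ≥ M — in some
coordinate |z_μ − k_μM| > 2M while |y_μ − k_μM| ≤ M (*"□̃ containing □ in the middle and of the size 4M"*, □ of the size
2M: the collar has width M). [cite: Balaban1984PropagatorsII, p.235 before (2.70)] -/
theorem collar {m : ℕ} {k : Fin d → Fin C} {y z : Fin d → Fin S} (hy : InCube m k y) (hz : ¬ InBig m k z) :
    (m : ℝ) ≤ bdist y z := by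
  obtain ⟨μ, hμ⟩ := not_forall.mp hz
  have h1 : 2 * (m : ℝ) < |crd z μ - ctr m k μ| := not_le.mp hμ
  have h2 := hy μ
  have h3 : |crd z μ - ctr m k μ| - |crd y μ - ctr m k μ| ≤ |crd y μ - crd z μ| := by
    have := abs_sub_abs_le_abs_sub (crd z μ - ctr m k μ) (crd y μ - ctr m k μ)
    rw [sub_sub_sub_cancel_right, abs_sub_comm (crd z μ) (crd y μ)] at this
    exact this
  linarith [abs_crd_sub_le_bdist y z μ]

/-- Membership in the zone (the binder `hzone` holds by construction). [folklore] -/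
theorem mem_zone {m : ℕ} {w : ℝ} {k : Fin d → Fin C} {x : Fin d → Fin S} :
    x ∈ zone m w k ↔ ∃ z : Fin d → Fin S, ¬ InBig m k z ∧ bdist x z ≤ w := by
  unfold zone
  simp only [Finset.mem_filter, Finset.mem_univ, true_and]

/-- **Non-empty zones** (the binder `hN`): for d ≥ 1, M ≥ 1, n ≥ 5 and w ≥ 0 every enlarged cube □̃_k (side 4M) misses
some site of the box {0, …, nM}^d (side nM ≥ 5M), and that site lies in the zone N_k. [folklore] -/
theorem zone_nonempty {n m : ℕ} (hd : 0 < d) (hm : 0 < m) (hn : 5 ≤ n) {w : ℝ} (hw : 0 ≤ w)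
    (k : Fin d → Fin (n + 1)) : (zone m w k : Finset (Fin d → Fin (n * m + 1))).Nonempty := by
  have hm' : (0 : ℝ) < m := by exact_mod_cast hm
  have hn' : (5 : ℝ) ≤ n := by exact_mod_cast hn
  obtain ⟨z, hz⟩ : ∃ z : Fin d → Fin (n * m + 1), ¬ InBig m k z := by
    by_cases hk : (k ⟨0, hd⟩ : ℕ) ≤ 2
    · refine ⟨fun _ => Fin.last (n * m), fun h => ?_⟩
      have h0 := h ⟨0, hd⟩
      have hc : crd (fun _ : Fin d => Fin.last (n * m)) ⟨0, hd⟩ = (n : ℝ) * m := by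
        simp [crd]
      have hk' : ((k ⟨0, hd⟩ : ℕ) : ℝ) ≤ 2 := by exact_mod_cast hk
      rw [hc, ctr] at h0
      have h1 : (n : ℝ) * m - ((k ⟨0, hd⟩ : ℕ) : ℝ) * m ≤ 2 * m := le_trans (le_abs_self _) h0
      have h2 : 3 * (m : ℝ) ≤ ((n : ℝ) - ((k ⟨0, hd⟩ : ℕ) : ℝ)) * m :=
        mul_le_mul_of_nonneg_right (by linarith) hm'.le
      nlinarith
    · refine ⟨fun _ => 0, fun h => ?_⟩
      have h0 := h ⟨0, hd⟩
      have hc : crd (fun _ : Fin d => (0 : Fin (n * m + 1))) ⟨0, hd⟩ = 0 := by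
        simp [crd]
      have hk' : (3 : ℝ) ≤ ((k ⟨0, hd⟩ : ℕ) : ℝ) := by exact_mod_cast (by omega : 3 ≤ (k ⟨0, hd⟩ : ℕ))
      rw [hc, ctr, zero_sub, abs_neg, abs_of_nonneg (by positivity)] at h0
      nlinarith
  exact ⟨z, mem_zone.mpr ⟨z, hz, by rw [bdist_self]; exact hw⟩⟩

end Box

/-! ## §3  The one-level box geometry and its metric binders: hsep, (2.60), the (2.61)-profile, (2.61)′, (2.63)′ -/

section Geo

/-- **The one-level box geometry**: 𝔅 = Λ_j scaled to the unit lattice = the box {0, …, nM}^d (n^d big blocks of size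
M = m), every site at scale j, d = the ℓ¹ lattice distance in L^jη-units ((2.46) on one level), the parameters k, η, L, R
free, M = m; the localisation vocabulary trivial (as in the siblings' consistency models `B6Prop23Assembled.ptGeo`,
`B6Prop23TwoLevel.tlGeo` — it is not used by the Proposition 2.3 chain).
[cite: Balaban1984PropagatorsII, (2.1)–(2.4) p.224; p.229 before (2.36); (2.46) p.231] -/
@[reducible] noncomputable def boxGeo (d n m j kk : ℕ) (L η R : ℝ) : B6.Geometry where
  Site := Fin d → Fin (n * m + 1)
  fin := inferInstance
  scale := fun _ => j
  dist := bdist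
  k := kk
  eta := η
  L := L
  R := R
  M := m
  Hyp21_22 := True
  Loc := PUnit
  suppIn := fun _ _ => True
  supNorm := fun _ => 0
  l2Norm := fun _ => 0
  holder := fun _ _ => 0
  Cut := PUnit
  cutIn := fun _ _ => True
  cutH := fun _ _ => 0
  cutSup := fun _ => 0

/-- The volume-independent lattice-sum constant K(a) = (2(1 − e^{−a})^{−1})^d of the ℓ¹ box sums (the c₁-type constant
of (2.61) in the model). [cite: Balaban1984PropagatorsII, (2.61) p.234] -/
noncomputable def Kbox (d : ℕ) (a : ℝ) : ℝ := (2 * (1 - Real.exp (-a))⁻¹) ^ d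

/-- K(a) ≥ 0 for a > 0 (the binder `hK`). [folklore] -/
theorem Kbox_nonneg (d : ℕ) {a : ℝ} (ha : 0 < a) : 0 ≤ Kbox d a := by
  unfold Kbox
  apply pow_nonneg
  have h1 : Real.exp (-a) < 1 := Real.exp_lt_one_iff.mpr (by linarith)
  have h2 : 0 < (1 - Real.exp (-a))⁻¹ := inv_pos.mpr (by linarith)
  exact mul_nonneg zero_le_two h2.le

variable (d n m j kk : ℕ) (L η R : ℝ)


/-- hρ on the model. [folklore] -/
theorem boxGeo_isPseudoDist : IsPseudoDist (boxGeo d n m j kk L η R).dist := isPseudoDist_bdist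

/-- (2.54) on the model. [cite: Balaban1984PropagatorsII, (2.54) p.233] -/
theorem boxGeo_triangle : Triangle254 (boxGeo d n m j kk L η R) := fun a b c => bdist_triangle a b c

/-- **hsep on one level**: max{|j − j| − 1, 0} = 0, so RM·0 ≤ d. [cite: Balaban1984PropagatorsII, (2.60) p.234] -/
theorem boxGeo_levelSep : LevelSep (boxGeo d n m j kk L η R) := by
  intro y y'
  have h : mx (boxGeo d n m j kk L η R) y y' = 0 := by simp [B6Ineq268.mx]
  rw [h, mul_zero]
  exact bdist_nonneg y y'

/-- **(2.60) on one level**: its right side is e⁰ = 1 and e^{−α′δ₀d} ≤ 1 for α′δ₀ ≥ 0 (the binder `h260`).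
[cite: Balaban1984PropagatorsII, (2.60) p.234] -/
theorem boxGeo_ineq260 {δ₀ α' : ℝ} (hα' : 0 ≤ α' * δ₀) : Ineq260 (boxGeo d n m j kk L η R) δ₀ α' := by
  intro y y'
  have hmax :
      max (|((boxGeo d n m j kk L η R).scale y : ℝ) - (boxGeo d n m j kk L η R).scale y'| - 1) 0 = 0 := by simp
  rw [hmax, mul_zero, neg_zero, Real.exp_zero]
  apply Real.exp_le_one_iff.mpr
  have h1 : 0 ≤ α' * δ₀ * bdist y y' := mul_nonneg hα' (bdist_nonneg y y')
  show -(α' * δ₀ * bdist y y') ≤ 0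
  linarith

/-- One row of the box in one coordinate: Σ_{t=0}^{S−1} e^{−a|s_μ − t|} ≤ 2(1 − e^{−a})^{−1}, uniformly in S — the tree's
`B4Sect5Proof.sum_exp_neg_abs_le` on the image of the row in ℤ. [folklore] -/
theorem rowSum_le {d S : ℕ} (s : Fin d → Fin S) (μ : Fin d) {a : ℝ} (ha : 0 < a) :
    ∑ t : Fin S, Real.exp (-(a * |crd s μ - ((t : ℕ) : ℝ)|)) ≤ 2 * (1 - Real.exp (-a))⁻¹ := by
  classical
  have h := B4Sect5Proof.sum_exp_neg_abs_le (Finset.univ.image fun t : Fin S => ((t : ℕ) : ℤ))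
    ((s μ : ℕ) : ℤ) ha
  rw [Finset.sum_image (fun x _ y _ hxy => Fin.ext (by exact_mod_cast hxy))] at h
  simpa [crd] using h

/-- **The (2.61)-profile of the box, uniformly in the volume** (the binders `hPr`, and `hK` via `Kbox_nonneg`):
Σ_{y ∈ 𝔅} e^{−a d(s, y)} ≤ (2(1 − e^{−a})^{−1})^d for every a > 0 and every s — e^{−aΣ_μ|s_μ − y_μ|} = Π_μ e^{−a|s_μ − y_μ|},
the sum over the box factorises over the coordinates (`Finset.prod_univ_sum`) and each factor is a row sum.
[cite: Balaban1984PropagatorsII, (2.61) p.234] -/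
theorem boxGeo_profile : Profile (boxGeo d n m j kk L η R).dist (fun a => a) (Kbox d) := by
  classical
  intro a ha s
  show ∑ y : Fin d → Fin (n * m + 1), Real.exp (-(a * bdist s y)) ≤ Kbox d a
  have hfac : ∀ y : Fin d → Fin (n * m + 1),
      Real.exp (-(a * bdist s y)) = ∏ μ, Real.exp (-(a * |crd s μ - crd y μ|)) := by
    intro y
    rw [bdist, Finset.mul_sum, ← Finset.sum_neg_distrib, Real.exp_sum]
  calc ∑ y : Fin d → Fin (n * m + 1), Real.exp (-(a * bdist s y))
      = ∑ y ∈ Fintype.piFinset (fun _ : Fin d => (Finset.univ : Finset (Fin (n * m + 1)))),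
          ∏ μ, Real.exp (-(a * |crd s μ - ((y μ : ℕ) : ℝ)|)) := by
        rw [Fintype.piFinset_univ]
        exact Finset.sum_congr rfl fun y _ => hfac y
    _ = ∏ μ : Fin d, ∑ t : Fin (n * m + 1), Real.exp (-(a * |crd s μ - ((t : ℕ) : ℝ)|)) :=
        (Finset.prod_univ_sum (fun _ : Fin d => (Finset.univ : Finset (Fin (n * m + 1))))
          (fun μ (t : Fin (n * m + 1)) => Real.exp (-(a * |crd s μ - ((t : ℕ) : ℝ)|)))).symm
    _ ≤ ∏ _μ : Fin d, 2 * (1 - Real.exp (-a))⁻¹ :=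
        Finset.prod_le_prod (fun μ _ => Finset.sum_nonneg fun t _ => (Real.exp_pos _).le)
          fun μ _ => rowSum_le s μ ha
    _ = Kbox d a := by
        rw [Finset.prod_const, Finset.card_univ, Fintype.card_fin]
        rfl

/-- **(2.61) with the constant K(αδ₀) on the model**, for αδ₀ > 0 (the binders `h261σ`, `h261`).
[cite: Balaban1984PropagatorsII, (2.61) p.234] -/
theorem boxGeo_ineq261With {δ₀ α : ℝ} (h : 0 < α * δ₀) : Ineq261With (Kbox d (α * δ₀)) (boxGeo d n m j kk L η R) δ₀ α :=
  fun y => boxGeo_profile d n m j kk L η R (α * δ₀) h y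

/-- **(2.63) with the constant K(αδ₀) on the model** (the binder `h263`): from (2.61)′ and (2.54) by the tree's
`B6Lemma21Repaired.ineq263With_of_261With`. [cite: Balaban1984PropagatorsII, (2.63) p.234] -/
theorem boxGeo_ineq263With {δ₀ α : ℝ} (h : 0 < α * δ₀) (hδ : 0 ≤ δ₀) (hα : α ≤ 1) :
    Ineq263With (Kbox d (α * δ₀)) (boxGeo d n m j kk L η R) δ₀ α :=
  B6Lemma21Repaired.ineq263With_of_261With (boxGeo_triangle d n m j kk L η R) hδ hα
    (boxGeo_ineq261With d n m j kk L η R h)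

end Geo

/-! ## §4  Proposition 2.3 on the box model: the cover ∕ cube ∕ collar ∕ zone ∕ metric binders discharged -/

section Edge

variable (d n m j kk : ℕ) (L η R : ℝ)


/-- **PROPOSITION 2.3 ON THE COORDINATISED ONE-LEVEL COVER** — `B6Prop23CubeDepth.prop23_assembled_fine_twoLevel_cubes`
(p. 238 before (2.85) ⟹ (2.85) ⟹ Lemma 2.1 ⟹ (2.86)–(2.87), change-of-domain input and depth binders discharged upstream)
ON the box geometry `boxGeo d n m j kk L η R` with the PRINTED cover: □_i := the indicator `cubeInd m i` of the 2M-cube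
with centre iM (i ∈ {0, …, n}^d), h_i := `hprof m i` (Π_μ h((x_μ − i_μM)∕M), [B5] (1.118)), j_□ := j, □̃_i := the 4M-cube
`InBig m i`, N_i := `zone m w i`; the binders hρ, hsep, hM, h260, hK, hPr, h261σ, h261, h263, hc, hs, hmg, hover
(n₀ = 2^d), hpf01, hph, h236, hLip (s = 3π∕2), hcube, hgap (m_g = ⅓), hN, hκ (κ = ½), hpfsq, hhsq, hcollar (M_c = M),
hzone, hdepth are DISCHARGED by §§2–3; the model needs d ≥ 1, M ≥ 1, n ≥ 5 and a zone width 0 ≤ w ≤ M∕2.  Kept VERBATIM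
(with these substitutions): the sizes of L, η, R (hL, hη, hRM, hsize, hthr), the rates (hα′, hκδ, hB₁, hθ, hsplit; the two
(2.61)-constants are K(σ(δ − α′δ₀)∕3) and K(δ₁∕2), so 0 < σ(δ − α′δ₀)∕3 and 0 < δ₁ are assumed), the kernels X, X̃_i, C_i
with (2.76)-type bounds hX ∕ hXw, (2.81) h281, hCk0, (2.70) h270, the fine-lattice data blk, χ_i, D_i, G′, G′(□̃_i) with
hχ1, hpfχ, hhχ, hχN, hGD, hDG, hχGw, hGwχ and the majorants hG, hGw, hKGw, hKG, the Q′-data, the dictionary hXdef ∕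
hXwdef, and «M large» hKM (with n₀ = 2^d, s = 3π∕2, c_σ = K(σ(δ − α′δ₀)∕3), c₃ = ((δ − α′δ₀)∕3)·½, m_g = ⅓, c = K(δ₁∕2));
conclusion verbatim: the two-sided inverse of Q′G′²Q′* in the pairing (2.69), its glued form (2.86), uniqueness, and
(2.87) with the same O(1). [cite: Balaban1984PropagatorsII, Proposition 2.3 (2.85)–(2.87) p.238; (2.36) p.229; p.235 before (2.70)] -/
theorem prop23_assembled_box (hd : 0 < d) (hm : 0 < m) (hn : 5 ≤ n) (hL : 1 ≤ L) (hη : 0 < η) (hRM : 0 ≤ R * m)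
    {X : Type}
    -- the fine-lattice side: blocks, the located size condition
    (blk : X → (boxGeo d n m j kk L η R).Site) {δ₀ α' : ℝ} (hα' : 0 ≤ α' * δ₀)
    (hsize : L ^ 2 * Real.exp (-(α' * δ₀ * (R * m))) ≤ 1)
    {δ B₁ θ : ℝ} (hκδ : α' * δ₀ < δ) (hB₁ : 0 ≤ B₁) (hθ : 0 ≤ θ)
    -- the rates of the assembled Prop. 2.3 (its δ₀ is (δ − α′δ₀)/3)
    {δ₁ σ BX BC : ℝ} (hδ₁ : 0 < δ₁) (hsplit : δ₁ + σ * ((δ - α' * δ₀) / 3) ≤ (δ - α' * δ₀) / 3 / 4)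
    (hσ : 0 < σ * ((δ - α' * δ₀) / 3))
    (hthr : L ^ 4 ≤ Real.exp (1 / 8 * ((δ - α' * δ₀) / 3) * R * m))
    (hBX : 0 ≤ BX) (hBC : 0 ≤ BC)
    -- the kernels X, X̃_i, C_i in the pairing (2.69)
    {Xk : (boxGeo d n m j kk L η R).Site → (boxGeo d n m j kk L η R).Site → ℝ}
    {Xwk Ck : (Fin d → Fin (n + 1)) → (boxGeo d n m j kk L η R).Site → (boxGeo d n m j kk L η R).Site → ℝ}
    (hX : ∀ y y'', |(boxGeo d n m j kk L η R).len y'' ^ d * Xk y y''| ≤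
      BX * (boxGeo d n m j kk L η R).len y ^ 4 *
        Real.exp (-(1 / 2 * ((δ - α' * δ₀) / 3) * (boxGeo d n m j kk L η R).dist y y'')))
    (hXw : ∀ i y y'', |(boxGeo d n m j kk L η R).len y'' ^ d * Xwk i y y''| ≤
      BX * (boxGeo d n m j kk L η R).len y ^ 4 *
        Real.exp (-(1 / 2 * ((δ - α' * δ₀) / 3) * (boxGeo d n m j kk L η R).dist y y'')))
    (h281 : ∀ i y y', cubeInd m i y ≠ 0 → cubeInd m i y' ≠ 0 →
      |Ck i y y'| ≤
        BC / ((boxGeo d n m j kk L η R).L ^ j * (boxGeo d n m j kk L η R).eta) ^ (d + 4) * Real.exp (-(δ₁ * (boxGeo d n m j kk L η R).dist y y')))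
    (hCk0 : ∀ i y'' y', cubeInd m i y'' = 0 → Ck i y'' y' = 0)
    (h270 : ∀ i, locOp (fun i => B6Expansion282.mulOp (cubeInd m i))
        (fun i => kerOp (fun z => (boxGeo d n m j kk L η R).len z ^ d) (Xwk i)) i *
      kerOp (fun z => (boxGeo d n m j kk L η R).len z ^ d) (Ck i) * B6Expansion282.mulOp (hprof m i) =
        B6Expansion282.mulOp (hprof m i))
    -- the fine-lattice data of each cube: cut-off χ_i, D_i, G′(□̃_i) = Gw i; G′ = G, Q′ = Qp, Q′* = Qs; zone width w
    {w : ℝ} (hw0 : 0 ≤ w) (hw : 2 * w ≤ m)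
    {G : Module.End ℝ (X → ℝ)} {Dop Gw : (Fin d → Fin (n + 1)) → Module.End ℝ (X → ℝ)}
    {χ : (Fin d → Fin (n + 1)) → X → ℝ}
    (hχ1 : ∀ i x, |χ i x| ≤ 1)
    (hpfχ : ∀ i x, cubeInd m i (blk x) * χ i x = cubeInd m i (blk x))
    (hhχ : ∀ i x, χ i x * hprof m i (blk x) = hprof m i (blk x))
    (hχN : ∀ i x, blk x ∉ zone m w i → χ i x = 1)
    (hGD : ∀ i, G * Dop i = 1) (hDG : ∀ i, Dop i * G = 1)
    (hχGw : ∀ i, B9Thm37Sum.mulOp (χ i) * Dop i * Gw i = B9Thm37Sum.mulOp (χ i))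
    (hGwχ : ∀ i, Gw i * Dop i * B9Thm37Sum.mulOp (χ i) = B9Thm37Sum.mulOp (χ i))
    (hG : HasMajorant blk G (fun a b => B₁ * (boxGeo d n m j kk L η R).len a ^ 2 * Real.exp (-(δ * (boxGeo d n m j kk L η R).dist a b))))
    (hGw : ∀ i, HasMajorant blk (Gw i) (fun a b => B₁ * (boxGeo d n m j kk L η R).len a ^ 2 * Real.exp (-(δ * (boxGeo d n m j kk L η R).dist a b))))
    (hKGw : ∀ i, HasMajorant blk ((B9Thm37Sum.mulOp (χ i) * Dop i - Dop i * B9Thm37Sum.mulOp (χ i)) * Gw i)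
      (fun a b => (if a ∈ zone m w i then θ else 0) * Real.exp (-(δ * (boxGeo d n m j kk L η R).dist a b))))
    (hKG : ∀ i, HasMajorant blk ((B9Thm37Sum.mulOp (χ i) * Dop i - Dop i * B9Thm37Sum.mulOp (χ i)) * G)
      (fun a b => (if a ∈ zone m w i then θ else 0) * Real.exp (-(δ * (boxGeo d n m j kk L η R).dist a b))))
    -- the Q′-data
    {Qp : (X → ℝ) →ₗ[ℝ] ((boxGeo d n m j kk L η R).Site → ℝ)} {Qs : ((boxGeo d n m j kk L η R).Site → ℝ) →ₗ[ℝ] (X → ℝ)}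
    {cQ cQs : ℝ} (hcQ : 0 ≤ cQ) (hcQs : 0 ≤ cQs)
    (hQ : HasMajorantHom blk (fun y : (boxGeo d n m j kk L η R).Site => y) Qp
      (fun (a b : (boxGeo d n m j kk L η R).Site) => cQ * (if a = b then (1 : ℝ) else 0)))
    (hQs : HasMajorantHom (fun y : (boxGeo d n m j kk L η R).Site => y) blk Qs
      (fun (a b : (boxGeo d n m j kk L η R).Site) => cQs * (if a = b then (1 : ℝ) else 0)))
    (hQχ : ∀ i : Fin d → Fin (n + 1), (B9Thm37Sum.mulOp (cubeInd m i) : Module.End ℝ ((boxGeo d n m j kk L η R).Site → ℝ)) ∘ₗ Qp =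
      Qp ∘ₗ (B9Thm37Sum.mulOp (cubeInd m i ∘ blk) : Module.End ℝ (X → ℝ)))
    (hQsh : ∀ i : Fin d → Fin (n + 1), Qs ∘ₗ (B9Thm37Sum.mulOp (hprof m i) : Module.End ℝ ((boxGeo d n m j kk L η R).Site → ℝ)) =
      (B9Thm37Sum.mulOp (hprof m i ∘ blk) : Module.End ℝ (X → ℝ)) ∘ₗ Qs)
    -- the dictionary (definitions of X, X̃_i as the (2.69)-kernels of Q′G′²Q′*, Q′G′(□̃_i)²Q′*)
    (hXdef : kerOp (fun z => (boxGeo d n m j kk L η R).len z ^ d) Xk = Qp ∘ₗ (G * G) ∘ₗ Qs)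
    (hXwdef : ∀ i, kerOp (fun z => (boxGeo d n m j kk L η R).len z ^ d) (Xwk i) = Qp ∘ₗ (Gw i * Gw i) ∘ₗ Qs)
    -- «M large enough», with the model's constants
    (hKM : 2 * K285TL (boxGeo d n m j kk L η R) d (2 ^ d) (3 * π / 2) ((δ - α' * δ₀) / 3) (Kbox d (σ * ((δ - α' * δ₀) / 3)))
      ((δ - α' * δ₀) / 3 * (1 / 2)) (1 / 3) BX (cQ * cQs * ((boxGeo d n m j kk L η R).L ^ 2 * Ctot (Kbox d) B₁ θ (δ - α' * δ₀))) BC *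
      Kbox d (1 / 2 * δ₁) ≤ (boxGeo d n m j kk L η R).M) :
    ∃ Ginv : Module.End ℝ ((boxGeo d n m j kk L η R).Site → ℝ),
      Ginv * kerOp (fun z => (boxGeo d n m j kk L η R).len z ^ d) Xk = 1 ∧ kerOp (fun z => (boxGeo d n m j kk L η R).len z ^ d) Xk * Ginv = 1 ∧
      Ginv = Cglued (fun i => B6Expansion282.mulOp (hprof m i)) (fun i => kerOp (fun z => (boxGeo d n m j kk L η R).len z ^ d) (Ck i)) +
        Ginv * R282 (kerOp (fun z => (boxGeo d n m j kk L η R).len z ^ d) Xk) (fun i => B6Expansion282.mulOp (cubeInd m i))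
          (fun i => kerOp (fun z => (boxGeo d n m j kk L η R).len z ^ d) (Xwk i)) (fun i => B6Expansion282.mulOp (hprof m i))
          (fun i => kerOp (fun z => (boxGeo d n m j kk L η R).len z ^ d) (Ck i)) ∧
      (∀ G' : Module.End ℝ ((boxGeo d n m j kk L η R).Site → ℝ), G' * kerOp (fun z => (boxGeo d n m j kk L η R).len z ^ d) Xk = 1 → G' = Ginv) ∧
      ∀ y y', |mat Ginv y y' / (boxGeo d n m j kk L η R).len y' ^ d| ≤
        2 * ((2 ^ d : ℕ) * (BC * (boxGeo d n m j kk L η R).L ^ (d + 4))) * Kbox d (1 / 2 * δ₁) * (boxGeo d n m j kk L η R).len y ^ (-(4 : ℝ)) *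
          (boxGeo d n m j kk L η R).len y' ^ (-(d : ℝ)) * Real.exp (-(δ₁ / 2 * (boxGeo d n m j kk L η R).dist y y')) := by
  have hM : 0 < (boxGeo d n m j kk L η R).M := by
    show (0 : ℝ) < m
    exact_mod_cast hm
  have hδhalf : 0 < 1 / 2 * δ₁ := by linarith
  exact prop23_assembled_fine_twoLevel_cubes (g := (boxGeo d n m j kk L η R)) (ι := Fin d → Fin (n + 1)) (pf := cubeInd m) (hf := hprof m)
    (js := fun _ => j) (n₀ := 2 ^ d) (sq := InCube m) (bsq := InBig m) (Mc := (m : ℝ)) (κ := 1 / 2)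
    d (boxGeo_isPseudoDist d n m j kk L η R) (boxGeo_levelSep d n m j kk L η R) hL hη hM hRM blk
    (boxGeo_ineq260 d n m j kk L η R hα') (fun a ha => Kbox_nonneg d ha) (boxGeo_profile d n m j kk L η R) hα' hsize
    hκδ hB₁ hθ hδ₁.le hsplit (boxGeo_ineq261With d n m j kk L η R hσ) hthr
    (boxGeo_ineq261With d n m j kk L η R hδhalf)
    (boxGeo_ineq263With d n m j kk L η R hδhalf hδ₁.le (by norm_num)) (Kbox_nonneg d hδhalf)
    (by positivity) (by norm_num) hBX hBC
    (fun y => card_filter_hprof_ne_zero_le hm y) (cubeInd_zero_or_one m) (cubeInd_mul_hprof hm) (sum_hprof_sq hm)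
    (abs_hprof_sub_le hm) (fun _ _ _ => ⟨le_rfl, Nat.le_succ _⟩)
    (fun _ _ _ hy hy'' => gap_of_cubeInd_eq_zero hm hy hy'') hX hXw h281 hCk0 h270 (zone m w)
    (zone_nonempty hd hm hn hw0) hχ1 hpfχ hhχ hχN hGD hDG hχGw hGwχ hG hGw hKGw hKG one_half_pos
    (fun _ _ h => inCube_of_cubeInd_ne_zero h) (fun _ _ h => inCube_of_hprof_ne_zero hm h)
    (fun _ _ _ hy hz => collar hy hz) (fun _ _ hx => mem_zone.mp hx) (depth_half hw) hcQ hcQs hQ hQs hQχ hQsh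
    hXdef hXwdef hKM

end Edge

/-! ## §5  The model hypotheses hold together -/

/-- The side conditions of the model (d ≥ 1, M ≥ 1, n ≥ 5, 0 ≤ w, 2w ≤ M) are jointly satisfiable — d = 1, M = 2,
n = 5, w = 1 — and on that instance every cube index has a non-empty zone and (2.36) holds at every site. [folklore] -/
theorem coverBox_nonvacuous :
    ∃ d n m : ℕ, ∃ w : ℝ, 0 < d ∧ 0 < m ∧ 5 ≤ n ∧ 0 ≤ w ∧ 2 * w ≤ m ∧
      (∀ k : Fin d → Fin (n + 1), (zone m w k : Finset (Fin d → Fin (n * m + 1))).Nonempty) ∧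
      (∀ x : Fin d → Fin (n * m + 1), ∑ k : Fin d → Fin (n + 1), hprof m k x ^ 2 = 1) := by
  refine ⟨1, 5, 2, 1, Nat.one_pos, two_pos, le_rfl, zero_le_one, by norm_num, ?_, ?_⟩
  · exact fun k => zone_nonempty Nat.one_pos two_pos le_rfl zero_le_one k
  · exact fun x => sum_hprof_sq two_pos x

end Literature.MathematicalPhysics.QuantumFieldTheory.Balaban1983to89.B6CoverBox
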